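import Literature.NumberTheory.DiophantineGeometry.XYZConjectureABCExponent
import Literature.NumberTheory.DiophantineGeometry.GenEllThm21With
import HarnessLib

/-!
# A polynomial abc bound with exponent `e` is the weak abc conjecture with `κ₁ = 1/e`

Topic `NumberTheory/DiophantineGeometry` (the `AbcWave0` neighbourhood); PROOF-ONLY companion of
`XYZConjectureABCExponent.lean` (the predicate `ABCExponentBound κ₁` of Lagarias–Soundararajan,
*Smooth solutions to the abc equation: the xyz conjecture*, JTNB 23 (2011) §1: "there is a positive
constant `κ₁` such that for any `ε > 0` there are only finitely many primitive solutions `(A, B, C)` to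
`A + B = C` such that `R(A, B, C) ≤ H(A, B, C)^{κ₁ − ε}`") and of `AbcWave0QualityFormProofs.lean`
(`abcQualityForm_of_forall_exists_const`: the `C(ε)` form ⟹ the quality form, i.e. the case `e = 1`).

* `abcExponentBound_inv_of_forall_exists_const` — if for every `ε > 0` there is `C > 0` with
  `c < C·rad(abc)^{e+ε}` for every abc triple (`e > 0`), then `ABCExponentBound (1/e)`. Elementary
  (`c < C·c^{θ}` with `θ < 1` bounds `c`); this is the dictionary by which POLYNOMIAL abc bounds
  (e.g. Stewart–Yu-type or conditional ones with exponent `3+ε`, `3/μ+ε`) are recorded in the paper's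
  `κ₁`-parametrisation. Nothing about any instance of `ABCExponentBound` is asserted.
* (v2 append) `abcWithExponent_iff_abcExponentBound_inv` — for `Λ > 0`, `GenEll.ABCWithExponent Λ ↔ ABCExponentBound (1/Λ)`
  (the R-H exponent programme's predicate of `GenEllThm21With.lean` is the same currency); `not_abcWithExponent_of_lt_one`.

## References

* [LagariasSoundararajan2011] Lagarias–Soundararajan, JTNB 23 (2011), doi:10.5802/jtnb.757, §1.
-/

noncomputable section

open Real UniqueFactorizationMonoid

namespace Literature.NumberTheory.DiophantineGeometry

/-! ### `c < C_ε·rad(abc)^{e+ε}` for all `ε > 0` ⟹ `ABCExponentBound (1/e)` -/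

/-- **A POLYNOMIAL abc bound with exponent `e` is the weak abc conjecture with `κ₁ = 1/e`**: if for every
`ε > 0` there is `C > 0` with `c < C·rad(abc)^{e+ε}` for every abc triple (`e > 0`), then
`ABCExponentBound (1/e)` — for every `ε' > 0` only finitely many abc triples have `rad(abc) ≤ c^{1/e − ε'}`
(with `ε = e²ε'/2`: such a triple has `c < C·c^{θ}`, `θ = (1/e − ε')(e + ε) = 1 − (eε'/2)(1 + eε') < 1`, so `c`
is bounded; at `1/e ≤ ε'` the set is empty since `rad ≥ 2`). At `e = 1` this is the `C(ε)` form ⟹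
`ABCExponentBound 1` (`abcQualityForm_of_forall_exists_const` + `abcExponentBound_one_iff_abcQualityForm`).
[cite: LagariasSoundararajan2011, §1 (abc conjecture, weak form)] -/
theorem abcExponentBound_inv_of_forall_exists_const {e : ℝ} (he : 0 < e)
    (H : ∀ ε : ℝ, 0 < ε → ∃ C : ℝ, 0 < C ∧
      ∀ a b c : ℕ, IsABCTriple a b c → (c : ℝ) < C * ((rad a b c : ℕ) : ℝ) ^ (e + ε)) :
    ABCExponentBound (1 / e) := by
  intro ε' hε'
  by_cases hs : 1 / e ≤ ε'
  · -- `c^{1/e − ε'} ≤ 1 < 2 ≤ rad`: the set is empty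
    refine Set.Finite.subset (Set.finite_empty) ?_
    rintro ⟨a, b, c⟩ ⟨ht, hR⟩
    dsimp only at ht hR
    have hc1 : (1 : ℝ) ≤ c := by exact_mod_cast le_trans one_le_two ht.two_le
    have h2 : (2 : ℝ) ≤ (rad a b c : ℝ) := by exact_mod_cast ht.two_le_rad
    have : (c : ℝ) ^ (1 / e - ε') ≤ 1 := Real.rpow_le_one_of_one_le_of_nonpos hc1 (by linarith)
    exact absurd (h2.trans (hR.trans this)) (by norm_num)
  · push Not at hs
    -- the exponent gap `τ = 1 − θ`
    set s : ℝ := 1 / e - ε' with hs_def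
    have hs0 : 0 < s := by rw [hs_def]; linarith
    set ε : ℝ := e ^ 2 * ε' / 2 with hε_def
    have hε : 0 < ε := by positivity
    set τ : ℝ := e * ε' / 2 * (1 + e * ε') with hτ_def
    have hτ0 : 0 < τ := by positivity
    have hθ : s * (e + ε) = 1 - τ := by
      rw [hs_def, hε_def, hτ_def]
      field_simp
      ring
    obtain ⟨C, hC, hCabc⟩ := H ε hε
    -- `N` bounds `c` of every abc triple in the set
    set N : ℕ := ⌈C ^ (1 / τ)⌉₊ with hN
    refine ((Set.finite_Iic N).prod ((Set.finite_Iic N).prod (Set.finite_Iic N))).subset ?_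
    rintro ⟨a, b, c⟩ hmem
    obtain ⟨ht, hR⟩ : IsABCTriple a b c ∧ ((rad a b c : ℕ) : ℝ) ≤ (c : ℝ) ^ (1 / e - ε') := hmem
    have hlt : (c : ℝ) < C * (rad a b c : ℝ) ^ (e + ε) := hCabc a b c ht
    have hr0 : (0 : ℝ) < (rad a b c : ℝ) := by
      exact_mod_cast (show 0 < rad a b c from lt_of_lt_of_le (by norm_num) ht.two_le_rad)
    have hc1 : (1 : ℝ) ≤ c := by exact_mod_cast le_trans one_le_two ht.two_le
    have hc0 : (0 : ℝ) < c := zero_lt_one.trans_le hc1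
    -- `c < C·c^{1−τ}`
    have h1 : (c : ℝ) < C * (c : ℝ) ^ (1 - τ) := by
      have hpow : (rad a b c : ℝ) ^ (e + ε) ≤ ((c : ℝ) ^ s) ^ (e + ε) :=
        Real.rpow_le_rpow hr0.le hR (by positivity)
      rw [← Real.rpow_mul hc0.le, hθ] at hpow
      exact hlt.trans_le (mul_le_mul_of_nonneg_left hpow hC.le)
    -- `c^τ < C`
    have h2 : (c : ℝ) ^ τ < C := by
      have hsplit : (c : ℝ) ^ (1 - τ) * (c : ℝ) ^ τ = c := by
        rw [← Real.rpow_add hc0, show 1 - τ + τ = 1 by ring, Real.rpow_one]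
      have hpos : (0 : ℝ) < (c : ℝ) ^ (1 - τ) := Real.rpow_pos_of_pos hc0 _
      have h1' : (c : ℝ) ^ (1 - τ) * (c : ℝ) ^ τ < (c : ℝ) ^ (1 - τ) * C := by
        rw [hsplit, mul_comm _ C]; exact h1
      exact lt_of_mul_lt_mul_left h1' hpos.le
    -- `c < C^{1/τ}`, hence `c ≤ N`
    have h3 : (c : ℝ) ≤ N := by
      have h := Real.rpow_lt_rpow (Real.rpow_pos_of_pos hc0 _).le h2 (show (0 : ℝ) < 1 / τ by positivity)
      rw [← Real.rpow_mul hc0.le, show τ * (1 / τ) = 1 by field_simp, Real.rpow_one] at h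
      exact h.le.trans (Nat.le_ceil _)
    have hcN : c ≤ N := by exact_mod_cast h3
    obtain ⟨ha, hb, habc, -⟩ := ht
    simp only [Set.mem_prod, Set.mem_Iic]
    omega

/-! ### (v2 append, 2026-08-27) `GenEll.ABCWithExponent Λ ↔ ABCExponentBound (1/Λ)` — the exponent programme's predicate
([GenEll]-style `c < C_ε·rad^{Λ(1+ε)}`, `GenEllThm21With.lean`) IS Lagarias–Soundararajan's weak abc with `κ₁ = 1/Λ`; one currency, two spellings -/

/-- **`ABCWithExponent Λ ⟹ ABCExponentBound (1/Λ)`** (`Λ > 0`): `c < C_ε·rad^{Λ(1+ε)}` for all `ε` is `c < C·rad^{Λ+ε'}` for all `ε'`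
(`ε = ε'/Λ`), then `abcExponentBound_inv_of_forall_exists_const`. [cite: LagariasSoundararajan2011, §1 (abc conjecture, weak form)] -/
theorem abcExponentBound_inv_of_abcWithExponent {Λ : ℝ} (hΛ : 0 < Λ) (h : GenEll.ABCWithExponent Λ) :
    ABCExponentBound (1 / Λ) := by
  refine abcExponentBound_inv_of_forall_exists_const hΛ fun ε hε => ?_
  obtain ⟨C, hC, hK⟩ := h (ε / Λ) (by positivity)
  refine ⟨C, hC, fun a b c ht => ?_⟩
  have e : Λ * (1 + ε / Λ) = Λ + ε := by field_simp
  rw [← e]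
  exact hK a b c ht

/-- **`ABCExponentBound (1/Λ) ⟹ ABCWithExponent Λ`** (`Λ > 0`): given `ε > 0`, at `ε' := ε/(Λ(1+ε))` one has `1/Λ − ε' = 1/(Λ(1+ε))`, so all but
finitely many abc triples satisfy `c^{1/(Λ(1+ε))} < rad(abc)`, i.e. `c < rad(abc)^{Λ(1+ε)}`; the finitely many exceptions have `c ≤ N`, and
`C := N + 2` serves (`rad ≥ 1`). [cite: LagariasSoundararajan2011, §1 (abc conjecture, weak form)] -/
theorem abcWithExponent_of_abcExponentBound_inv {Λ : ℝ} (hΛ : 0 < Λ) (h : ABCExponentBound (1 / Λ)) :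
    GenEll.ABCWithExponent Λ := by
  intro ε hε
  set ε' : ℝ := ε / (Λ * (1 + ε)) with hε'
  have hε'0 : 0 < ε' := by positivity
  have hexp : 1 / Λ - ε' = 1 / (Λ * (1 + ε)) := by
    rw [hε']
    field_simp
    ring
  have hs0 : 0 < Λ * (1 + ε) := by positivity
  have hfin := h ε' hε'0
  -- `N` bounds `c` over the finitely many exceptional triples
  obtain ⟨N, hN⟩ : ∃ N : ℕ, ∀ t ∈ {t : ℕ × ℕ × ℕ | IsABCTriple t.1 t.2.1 t.2.2 ∧
      ((rad t.1 t.2.1 t.2.2 : ℕ) : ℝ) ≤ (t.2.2 : ℝ) ^ (1 / Λ - ε')}, t.2.2 ≤ N := by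
    obtain ⟨N, hN⟩ := (hfin.image fun t => t.2.2).bddAbove
    exact ⟨N, fun t ht => hN (Set.mem_image_of_mem _ ht)⟩
  refine ⟨(N : ℝ) + 2, by positivity, fun a b c ht => ?_⟩
  have hN0 : (0 : ℝ) ≤ N := N.cast_nonneg
  have hr1 : (1 : ℝ) ≤ (rad a b c : ℝ) := by exact_mod_cast le_trans (by norm_num) ht.two_le_rad
  have hr0 : (0 : ℝ) < (rad a b c : ℝ) := zero_lt_one.trans_le hr1
  have hpow1 : (1 : ℝ) ≤ (rad a b c : ℝ) ^ (Λ * (1 + ε)) := Real.one_le_rpow hr1 hs0.le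
  have hc1 : (1 : ℝ) ≤ c := by exact_mod_cast le_trans one_le_two ht.two_le
  have hc0 : (0 : ℝ) < c := zero_lt_one.trans_le hc1
  by_cases hR : ((rad a b c : ℕ) : ℝ) ≤ (c : ℝ) ^ (1 / Λ - ε')
  · have hc : c ≤ N := hN (a, b, c) ⟨ht, hR⟩
    have hc' : (c : ℝ) ≤ N := by exact_mod_cast hc
    calc (c : ℝ) ≤ N := hc'
      _ < (N : ℝ) + 2 := by linarith
      _ = ((N : ℝ) + 2) * 1 := (mul_one _).symm
      _ ≤ ((N : ℝ) + 2) * (rad a b c : ℝ) ^ (Λ * (1 + ε)) := mul_le_mul_of_nonneg_left hpow1 (by positivity)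
  · rw [not_le, hexp] at hR
    -- `c^{1/(Λ(1+ε))} < rad` ⟹ `c < rad^{Λ(1+ε)}`
    have hlt : (c : ℝ) < (rad a b c : ℝ) ^ (Λ * (1 + ε)) := by
      have h1 := Real.rpow_lt_rpow (Real.rpow_nonneg hc0.le _) hR hs0
      rwa [← Real.rpow_mul hc0.le, show 1 / (Λ * (1 + ε)) * (Λ * (1 + ε)) = 1 by field_simp, Real.rpow_one] at h1
    calc (c : ℝ) < (rad a b c : ℝ) ^ (Λ * (1 + ε)) := hlt
      _ = 1 * (rad a b c : ℝ) ^ (Λ * (1 + ε)) := (one_mul _).symm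
      _ ≤ ((N : ℝ) + 2) * (rad a b c : ℝ) ^ (Λ * (1 + ε)) :=
        mul_le_mul_of_nonneg_right (by linarith) (zero_lt_one.trans_le hpow1).le

/-- **One currency, two spellings**: for `Λ > 0`, `GenEll.ABCWithExponent Λ ↔ ABCExponentBound (1/Λ)` — the R-H exponent programme's «abc with
exponent `Λ`» is Lagarias–Soundararajan's weak abc conjecture with `κ₁ = 1/Λ` (`Λ = 1`: both are abc itself, `GenEll.abcWithExponent_one_iff` /
`abcExponentBound_one_iff_abcQualityForm`; `Λ < 1` ⟺ `κ₁ > 1` is false, `not_abcExponentBound_of_one_lt`). [cite: LagariasSoundararajan2011, §1] -/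
theorem abcWithExponent_iff_abcExponentBound_inv {Λ : ℝ} (hΛ : 0 < Λ) :
    GenEll.ABCWithExponent Λ ↔ ABCExponentBound (1 / Λ) :=
  ⟨abcExponentBound_inv_of_abcWithExponent hΛ, abcWithExponent_of_abcExponentBound_inv hΛ⟩

/-- **«abc with exponent `Λ < 1`» is false** (it would be the weak abc conjecture with `κ₁ = 1/Λ > 1`, refuted by the triples `(1, 2ⁿ−1, 2ⁿ)`:
`not_abcExponentBound_of_one_lt`). So in the exponent programme only `Λ ≥ 1` (`μ₀ ≤ 1`) carries content. [cite: LagariasSoundararajan2011, §1] -/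
theorem not_abcWithExponent_of_lt_one {Λ : ℝ} (hΛ0 : 0 < Λ) (hΛ1 : Λ < 1) : ¬ GenEll.ABCWithExponent Λ := fun h =>
  not_abcExponentBound_of_one_lt (by rw [lt_div_iff₀ hΛ0]; linarith) (abcExponentBound_inv_of_abcWithExponent hΛ0 h)

end Literature.NumberTheory.DiophantineGeometry

end
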